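import Summits.FinalStateConjecture.FinalStateConjecture.Theorems.EIHFluxBalanceModulatedKerrHandoffTameDefs
import Summits.FinalStateConjecture.FinalStateConjecture.Theorems.ZeroEnergyKerrOrBombStationaryLimitReductionIsometryTransport
import Literature.Geometry.Lorentzian.Isometry
import Literature.Geometry.Lorentzian.ConvergenceTransport
import HarnessLib

/-!
# Transport of the modulated multi-Kerr–Schild ansatz with handoff along an isometry of
# developments (registered stub `stub_handoffAnsatz_transport`, line `Sketch` = tame template, crux
# `EIHFluxBalance.ModulatedKerrHandoff`, item stmt-FinalStateConjecture-17402)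

Let `𝒟₁`, `𝒟₂` be vacuum Cauchy developments of the same initial data set `D` on `X`, and let
`ψ : M₁ ≃ M₂` be a time-orientation preserving isometric diffeomorphism with `ψ ∘ ι₁ = ι₂` (the
data of `CauchyDevelopment.IsIsometricTo`, i.e. of MGHD uniqueness up to isometry,
Choquet-Bruhat–Geroch 1969). GIVEN the transport of clause (R) `RaysStayInClosure` along `ψ` as a
hypothesis (landed separately as `stub_raysStayInClosure_transport`), the ansatz half
`HandoffAnsatz X D 𝒟` of the handoff clause (`EIHFluxBalanceModulatedKerrHandoffTameDefs.lean`: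
moduli `(N, M, a, rin, Λ, ξ, γ, κ, τ₀, U)`, a lab chart `Φ : U → M`, an exterior `O`, six
kinematic clauses on the moduli, smoothness and open-embedding of `Φ`, late exterior image in `O`,
unweighted and weighted `C³` deviation decay, `O = exteriorOf`, exhaustion, and the four handoff
clauses (T), (O), (R), (QS)) transports from `𝒟₁` to `𝒟₂` with the SAME moduli, the lab chart
`ψ ∘ Φ` and the exterior `ψ '' O`:
* the metric deviation of `ψ ∘ Φ` in `𝒟₂` is literally that of `Φ` in `𝒟₁`
  (`Spacetime.deviation_comp`, `ConvergenceTransport.lean`: chain rule for pullbacks,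
  O'Neill 1983, Ch. 3, p. 58), so both deviation clauses are unchanged;
* `ψ` carries `J⁺`, `J⁻`, `I⁻` of `𝒟₁` ONTO those of `𝒟₂` (`image_causalFuture_eq`,
  `image_causalPast_eq`, `image_chronologicalPast_eq` of
  `ZeroEnergyKerrOrBombStationaryLimitReductionIsometryTransport.lean`, namespace
  `…Theorems.OneLockedExplosion`; O'Neill 1983, Ch. 14, pp. 402–403) and `range ι₂ = ψ '' range ι₁`,
  so `exteriorOf`, exhaustion (with `Set.image_sdiff`, `ψ` injective) and (T) are transported;
* (O) and (QS) mention the painted moduli only; (R) is the hypothesis.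
Adapted from the standing disprover's sorry-free transport `handoffN_of_isIsometricTo_of`
(`Cruxes/ModulatedKerrHandoff/Disproof.lean`, §14, refuter-cdisprove-stmt-FinalStateConjecture-17402-0).
Mathlib + the Literature cone + two Theorems helper files only; no definitions, no named facts.
O'Neill, *Semi-Riemannian geometry* (1983), Ch. 3, p. 58, Ch. 14, pp. 402–403;
Dafermos–Luk arXiv:1710.01722, Conjecture 1.
Stub-worker of the line lead prover-line-stmt-FinalStateConjecture-17402-0, 2026-08-17.
-/

-- the summit-side namespace `Summit.FinalStateConjecture.FinalStateConjecture.…` (summit = problem)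
-- repeats a component by design, which the `dupNamespace` linter would flag on every decl.
set_option linter.dupNamespace false

noncomputable section

open scoped Manifold ContDiff Topology ENNReal
open Set Function Filter Literature.Geometry.Lorentzian

namespace Summit.FinalStateConjecture.FinalStateConjecture.Theorems.EIHFluxBalance.TameTemplate

open Summit.FinalStateConjecture.FinalStateConjecture.Theorems.OneLockedExplosion in
-- adapted from Cruxes/ModulatedKerrHandoff/Disproof.lean §14 (refuter-cdisprove-stmt-FinalStateConjecture-17402-0)
/-- **The modulated multi-Kerr–Schild ansatz with handoff transports along an isometry of
developments, given (R)-transport** (registered stub `stub_handoffAnsatz_transport` of line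
`Sketch`). For vacuum Cauchy developments `𝒟₁`, `𝒟₂` of `D`, a time-orientation preserving
isometric diffeomorphism `ψ : M₁ ≃ M₂` with `ψ ∘ ι₁ = ι₂`, and the transport of
`RaysStayInClosure` along `ψ` as a hypothesis: `HandoffAnsatz X D 𝒟₁ → HandoffAnsatz X D 𝒟₂`, with
the same moduli `(N, M, a, rin, Λ, ξ, γ, κ, τ₀, U)`, lab chart `ψ ∘ Φ` and exterior `ψ '' O`. The
deviation is unchanged (`Spacetime.deviation_comp`); `ψ` carries `J^±`, `I⁻`, the Cauchy surface and
set differences (`image_causalFuture_eq`, `image_causalPast_eq`, `image_chronologicalPast_eq`,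
`Set.image_sdiff`); (T) is transported because `ψ '' J⁺{Φ x} = J⁺{ψ (Φ x)}` and `ψ` is injective;
(O) and (QS) mention the painted moduli only. [cite: ONeillSemiRiemannian1983, Ch. 14, pp. 402–403] -/
theorem stub_handoffAnsatz_transport : ∀ (X : Type) [TopologicalSpace X] [ChartedSpace E3 X] [IsManifold (𝓡 3) ((⊤ : ℕ∞) : WithTop ℕ∞) X] [T2Space X] [SecondCountableTopology X] [ConnectedSpace X] (D : InitialDataSet (𝓡 3) X) (𝒟₁ 𝒟₂ : VacuumCauchyDevelopment D) (ψ : Diffeomorph (𝓡 4) (𝓡 4) 𝒟₁.carrier 𝒟₂.carrier ((⊤ : ℕ∞) : WithTop ℕ∞)), 𝒟₁.metric.IsIsometry 𝒟₂.metric.toPseudoRiemannianMetric ψ → 𝒟₁.timeOrientation.PreservesTimeOrientation ψ 𝒟₂.timeOrientation → ψ ∘ 𝒟₁.embed = 𝒟₂.embed → (∀ O : Set 𝒟₁.carrier, Summit.FinalStateConjecture.RaysStayInClosure 𝒟₁.toCauchyDevelopment O → Summit.FinalStateConjecture.RaysStayInClosure 𝒟₂.toCauchyDevelopment (ψ ''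 O)) → HandoffAnsatz X D 𝒟₁ → HandoffAnsatz X D 𝒟₂ := by
  intro X _ _ _ _ _ _ D 𝒟₁ 𝒟₂ ψ hiso hτ hι hR hA
  -- standard facts about `ψ`
  have hψd : MDifferentiable (𝓡 4) (𝓡 4) ψ := ψ.contMDiff.mdifferentiable (by simp)
  have hψ : ∀ y, pullbackBilin (I := 𝓡 4) (I' := 𝓡 4) ψ 𝒟₂.metric.val y = 𝒟₁.metric.val y := hiso
  have hinj : Injective (ψ : 𝒟₁.carrier → 𝒟₂.carrier) := ψ.injective
  -- transport of causal/chronological futures and pasts as EQUALITIES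
  have hJp : ∀ S : Set 𝒟₁.carrier, ψ '' 𝒟₁.metric.causalFuture 𝒟₁.timeOrientation S =
      𝒟₂.metric.causalFuture 𝒟₂.timeOrientation (ψ '' S) := fun S ↦
    image_causalFuture_eq ψ hiso hτ S
  have hJm : ∀ S : Set 𝒟₁.carrier, ψ '' 𝒟₁.metric.causalPast 𝒟₁.timeOrientation S =
      𝒟₂.metric.causalPast 𝒟₂.timeOrientation (ψ '' S) := fun S ↦
    image_causalPast_eq ψ hiso hτ S
  have hIm : ∀ S : Set 𝒟₁.carrier, ψ '' 𝒟₁.metric.chronologicalPast 𝒟₁.timeOrientation S =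
      𝒟₂.metric.chronologicalPast 𝒟₂.timeOrientation (ψ '' S) := fun S ↦
    image_chronologicalPast_eq ψ hiso hτ S
  have hrange : range 𝒟₂.embed = ψ '' range 𝒟₁.embed := by
    rw [← hι, Set.range_comp]
  -- unpack the ansatz of `𝒟₁`
  obtain ⟨N, Mh, a, rin, Λ, ξ, γ, κ, τ₀, U, Φ, O, h1, h2, h3, h4, h5, hU, hB⟩ := hA
  obtain ⟨hΦ, hemb, himO, hdev, hwt, hO, hexh, hT, hOc, hRay, hQS⟩ := hB
  have hΦd : MDifferentiable 𝓘(ℝ, E4) (𝓡 4) Φ := hΦ.mdifferentiable (by simp)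
  refine ⟨N, Mh, a, rin, Λ, ξ, γ, κ, τ₀, U, ψ ∘ Φ, ψ '' O, h1, h2, h3, h4, h5, hU, ?_⟩
  -- the deviation is unchanged (for every background on the chart domain `U`)
  have hdevEq : ∀ (b : E4 → E4 →L[ℝ] E4 →L[ℝ] ℝ) (tf rf : E4 → ℝ),
      𝒟₂.toSpacetime.deviationExtend ⟨U, b, tf, rf⟩ (ψ ∘ Φ) =
        𝒟₁.toSpacetime.deviationExtend ⟨U, b, tf, rf⟩ Φ := by
    intro b tf rf
    unfold Spacetime.deviationExtend
    rw [Spacetime.deviation_comp ⟨U, b, tf, rf⟩ hψd hψ hΦd]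
  have hCkEq : ∀ (b : E4 → E4 →L[ℝ] E4 →L[ℝ] ℝ) (tf rf : E4 → ℝ) (k : ℕ) (t : ℝ),
      𝒟₂.toSpacetime.deviationCk ⟨U, b, tf, rf⟩ (ψ ∘ Φ) k t =
        𝒟₁.toSpacetime.deviationCk ⟨U, b, tf, rf⟩ Φ k t := by
    intro b tf rf k t
    unfold Spacetime.deviationCk
    rw [hdevEq b tf rf]
  refine ⟨ψ.contMDiff.comp hΦ, ψ.toHomeomorph.isOpenEmbedding.comp hemb, ?_, ?_, ?_, ?_, ?_, ?_, hOc,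
    hR O hRay, hQS⟩
  · -- (9) late exterior image inside `ψ(O)`
    rw [image_comp]
    exact image_mono himO
  · -- (10) unweighted deviation
    simpa only [hCkEq] using hdev
  · -- (10') weighted deviation
    simpa only [hdevEq] using hwt
  · -- (11) the self-determined exterior is transported
    rw [hO, image_comp]
    unfold Summit.FinalStateConjecture.exteriorOf
    rw [image_inter hinj, hJp, hIm, hrange]
  · -- (12) exhaustion is transported
    intro t₁ ht₁
    rw [image_comp, image_comp, ← image_sdiff hinj, ← hJm]
    exact image_mono (hexh t₁ ht₁)
  · -- (T) lab-time causality is transported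
    obtain ⟨τ₁, hT⟩ := hT
    refine ⟨τ₁, fun x y hx hy hxy ↦ hT x y hx hy ?_⟩
    have h1 : ψ (Φ y) ∈ ψ '' 𝒟₁.metric.causalFuture 𝒟₁.timeOrientation {Φ x} := by
      rw [hJp, image_singleton]
      exact hxy
    obtain ⟨z, hz, hzq⟩ := h1
    rwa [← hinj hzq]

end Summit.FinalStateConjecture.FinalStateConjecture.Theorems.EIHFluxBalance.TameTemplate

end
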